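import Summits.BirchSwinnertonDyer.Rank1Residual.X11b.Three.TamagawaAtomClass
import Literature.NumberTheory.EllipticCurves.TamagawaRingEquivProofs
import HarnessLib

/-!
# Class X11b at `p = 3` (team N8/O2 = cell `b2b-bsdres`, sub-target T2P3-ANATOMY, seat x11b3-p3):
# NAMES for the three local shapes of the Tamagawa atom at `3`, and the interface to the sibling
# sub-target S2b ((T2β)@3 Shimura road) in its `ℚ_ℓ`-model currency

HONEST FRAMING (verbatim, cell `b2b-bsdres`, run/shared/lean/b2b/bsd-rank1-residual/): the goal of
the cell is to DELETE the COMBINATION-SHAPED residual classes for ALL analytic-rank `≤ 1` curves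
over `ℚ` — "full BSD formula for every rank `≤ 1` curve in class `C`" assembled STRICTLY from
published theorems — so that the rank-`≤ 1` remainder becomes exactly the CONSTRUCTION-SHAPED
classes, which are TYPED (missing-input Props), NOT attempted; this is not "finishing BSD".
Team N8/O2 (X11b at `3`: `3 ∥ N`, `r_an = 1`, `E[3]` irreducible; RESIDUAL-MAP §I O2 OPEN).
Research route; nothing booked; NO label changes. Three `Prop`-valued PREDICATES on a curve
(decidable local data — Tate's algorithm; nothing asserted, no named fact) and theorems; no `sorry`.

## What this file does

`TamagawaAtom.lean` / `TamagawaAtomClass.lean` (p249415 / p249738) state the three local shapes of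
the Tamagawa atom (T2′)@3 INLINE. The team lead asked for importable NAMES (cells/x11b3 PLAN v1.1:
sub-target S2c = the (T2γ)@3 carrier, S2b = the (T2β)@3 Shimura road, cc-eng-1's census bit (j)).
This file names them, VERBATIM the inline shapes:

* `ShapeAlpha W` — (T2α)@3: `E` SPLIT multiplicative at `3` with `3 ∣ ord_3(Δ_min)` (peu ramifié);
* `ShapeBeta W`  — (T2β)@3: some split multiplicative `ℓ ≠ 3` with `3 ∣ ord_ℓ(Δ_min)`;
* `ShapeGamma W` — (T2γ)@3: some place of Kodaira type `IV` or `IV*` with local Tamagawa number `3`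
  (an ADDITIVE prime `ℓ ≠ 3`; empty on semistable curves; no analogue at primes `p > 3`);

and records: `three_dvd_tamagawaProduct_iff_shapes` (`3 ∣ ∏c_ℓ ⟺ α ∨ β ∨ γ`, any globally minimal
elliptic `W/ℚ`), `not_shapeGamma_of_semistable`, `shapeGamma.addv` (a γ place lies over an `Addv`
prime `≠ 3` on X11b@3), and the INTERFACE to S2b in the `ℚ_ℓ`-model currency of multr1-p2's
inert-prime lemmas: **`hasSplitMultiplicativeReductionAtPrime_of_three_dvd_of_not_shapeGamma`** —
if `W` has no (T2γ)@3 place then at EVERY prime `q`, `3 ∣ c(W ⊗ ℚ_q)` forces split multiplicative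
reduction at `q` (S2b's hypothesis `hshape`), via the tree bridge `localTamagawaNumber_padic_eq`
between the `ℚ_q`-model and the place-indexed factor of `∏c_ℓ`. Census of record (EVIDENCE, two
engines, kit jobs j119963 ‖ j120492, this seat; 383 149 X11b@3 class-pairs): on the Tamagawa atom
`Ram ∧ 3 ∣ ∏c` (123 739) — α 46 804 · β 66 576 · γ 23 263; exclusive α-only 36 606 · β-only 56 508
(of which `2 ∣ N`: 47 168) · γ-only 17 961; γ = 0 on the 151 556 semistable pairs.

References: [SilvermanATAEC1994] IV.9.4 and Table 4.1 (PDF pp. 344–346), Cor. IV.9.2(d) (p. 340);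
[SilvermanAEC2009] VII.6 Ex. 7.6 (the `ℚ_q`-model transport); [JetchevSkinnerWan2017] §4.1 (H), §7.4.2.
-/

noncomputable section

open scoped Classical

open WeierstrassCurve NumberField IsDedekindDomain Literature.NumberTheory.EllipticCurves
  Rat.HeightOneSpectrum
  Literature.NumberTheory.DiophantineGeometry
  Literature.NumberTheory.EllipticCurves.Rank1Residual

namespace Summit.BirchSwinnertonDyer.Rank1Residual.X11b.Three

section Shapes

variable (W : WeierstrassCurve ℚ) [W.IsElliptic] [W.IsGloballyMinimal]

/-- **(T2α)@3**: `E` is SPLIT multiplicative at `3` and peu ramifié there, `3 ∣ ord_3(Δ_min(E))`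
(equivalently `3 ∣ c_3(E)`, Kodaira–Néron). Verbatim the first disjunct of `tamagawa_atom_shape_three`.
A decidable predicate on the curve (Tate's algorithm); nothing asserted. [cite: SilvermanATAEC1994, Cor. IV.9.2(d) (PDF p. 340)] -/
def ShapeAlpha [Fact (Nat.Prime 3)] : Prop :=
  W.HasSplitMultiplicativeReductionAtPrime 3 ∧ 3 ∣ padicValInt 3 W.minimalDiscriminantInt

/-- **(T2β)@3**: some SPLIT multiplicative prime `ℓ ≠ 3` with `3 ∣ ord_ℓ(Δ_min(E))` — a
multiplicative prime at which `ρ̄_{E,3}` is unramified and `3 ∣ c_ℓ(E)`. Verbatim the second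
disjunct of `tamagawa_atom_shape_three`. Decidable; nothing asserted. [cite: SilvermanATAEC1994, Cor. IV.9.2(d) (PDF p. 340)] -/
def ShapeBeta : Prop :=
  ∃ ℓ : ℕ, ∃ _ : Fact ℓ.Prime, ℓ ≠ 3 ∧ W.HasSplitMultiplicativeReductionAtPrime ℓ ∧
    3 ∣ padicValInt ℓ W.minimalDiscriminantInt

/-- **(T2γ)@3**: some finite place of `ℚ` at which `E` has Kodaira type `IV` or `IV*` AND local
Tamagawa number `3` (Tate's algorithm Steps 5 / 8: `c ∈ {1, 3}`) — an ADDITIVE prime, `≠ 3` on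
X11b@3 (`addv_of_typeIV`, `primesEquiv_ne_three_of_typeIV`), absent on semistable curves. Verbatim
the third disjunct of `tamagawa_atom_shape_three`. Decidable; nothing asserted.
[cite: SilvermanATAEC1994, IV.9.4 Steps 5 and 8 (PDF pp. 344–346)] -/
def ShapeGamma : Prop :=
  ∃ v : HeightOneSpectrum (𝓞 ℚ),
    (W.kodairaSymbolAt v = .IV ∨ W.kodairaSymbolAt v = .IVstar) ∧ W.tamagawaNumberAt v = 3

omit [W.IsElliptic] in
/-- Unfolding lemma. [folklore] -/
theorem shapeAlpha_iff [Fact (Nat.Prime 3)] :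
    ShapeAlpha W ↔
      W.HasSplitMultiplicativeReductionAtPrime 3 ∧ 3 ∣ padicValInt 3 W.minimalDiscriminantInt :=
  Iff.rfl

omit [W.IsElliptic] in
/-- Unfolding lemma. [folklore] -/
theorem shapeBeta_iff :
    ShapeBeta W ↔ ∃ ℓ : ℕ, ∃ _ : Fact ℓ.Prime, ℓ ≠ 3 ∧ W.HasSplitMultiplicativeReductionAtPrime ℓ ∧
      3 ∣ padicValInt ℓ W.minimalDiscriminantInt :=
  Iff.rfl

omit [W.IsElliptic] [W.IsGloballyMinimal] in
/-- Unfolding lemma. [folklore] -/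
theorem shapeGamma_iff :
    ShapeGamma W ↔ ∃ v : HeightOneSpectrum (𝓞 ℚ),
      (W.kodairaSymbolAt v = .IV ∨ W.kodairaSymbolAt v = .IVstar) ∧ W.tamagawaNumberAt v = 3 :=
  Iff.rfl

/-- **`3 ∣ ∏_ℓ c_ℓ(E) ⟺ (T2α)@3 ∨ (T2β)@3 ∨ (T2γ)@3`** for every globally minimal elliptic `W/ℚ`
(`three_dvd_tamagawaProduct_iff` with the split prime sorted into `ℓ = 3` / `ℓ ≠ 3`). Census (two
engines, 383 149 X11b@3 class-pairs): 0 violations. [cite: SilvermanATAEC1994, IV.9.4 Steps 2, 5, 8 and Table 4.1 (PDF pp. 344–346)] -/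
theorem three_dvd_tamagawaProduct_iff_shapes [Fact (Nat.Prime 3)] :
    3 ∣ W.tamagawaProduct ↔ ShapeAlpha W ∨ ShapeBeta W ∨ ShapeGamma W := by
  rw [three_dvd_tamagawaProduct_iff W]
  constructor
  · rintro (⟨ℓ, hℓ, hs, hd⟩ | hγ)
    · by_cases h3 : ℓ = 3
      · subst h3
        exact Or.inl ⟨hs, hd⟩
      · exact Or.inr (Or.inl ⟨ℓ, hℓ, h3, hs, hd⟩)
    · exact Or.inr (Or.inr hγ)
  · rintro (⟨hs, hd⟩ | ⟨ℓ, hℓ, -, hs, hd⟩ | hγ)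
    · exact Or.inl ⟨3, inferInstance, hs, hd⟩
    · exact Or.inl ⟨ℓ, hℓ, hs, hd⟩
    · exact Or.inr hγ

omit [W.IsGloballyMinimal] in
/-- **No (T2γ)@3 on a semistable curve.** [folklore] -/
theorem not_shapeGamma_of_semistable (hsst : Semistable W) : ¬ ShapeGamma W :=
  not_exists_typeIV_of_semistable W hsst

omit [W.IsGloballyMinimal] in
/-- **A (T2γ)@3 witness lies over an ADDITIVE prime** (cell vocabulary `Addv`). [folklore] -/
theorem ShapeGamma.exists_addv (h : ShapeGamma W) :
    ∃ v : HeightOneSpectrum (𝓞 ℚ), (haveI := Fact.mk (primesEquiv v).2; Addv W (primesEquiv v : ℕ)) ∧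
      W.tamagawaNumberAt v = 3 := by
  obtain ⟨v, hk, hc⟩ := h
  exact ⟨v, addv_of_typeIV W hk, hc⟩

omit [W.IsGloballyMinimal] in
/-- **On X11b@3 a (T2γ)@3 witness lies over a prime `ℓ ≠ 3`** (the place over `3` is multiplicative).
[folklore] -/
theorem ShapeGamma.exists_ne_three [Fact (Nat.Prime 3)] (hX : ClassX11b W 3) (h : ShapeGamma W) :
    ∃ v : HeightOneSpectrum (𝓞 ℚ), (primesEquiv v : ℕ) ≠ 3 ∧
      (W.kodairaSymbolAt v = .IV ∨ W.kodairaSymbolAt v = .IVstar) ∧ W.tamagawaNumberAt v = 3 := by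
  obtain ⟨v, hk, hc⟩ := h
  exact ⟨v, primesEquiv_ne_three_of_typeIV W hX hk, hk, hc⟩

/-- **The Tamagawa atom of X11b@3 by name**: `ClassX11b W 3 → 3 ∣ ∏c_ℓ → α ∨ β ∨ γ`
(`tamagawa_atom_shape_three`). [cite: SilvermanATAEC1994, IV.9.4 Steps 2, 5, 8 and Table 4.1 (PDF pp. 344–346)] -/
theorem ClassX11b.shapes_of_three_dvd [Fact (Nat.Prime 3)] (hX : ClassX11b W 3)
    (ht : 3 ∣ W.tamagawaProduct) : ShapeAlpha W ∨ ShapeBeta W ∨ ShapeGamma W :=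
  tamagawa_atom_shape_three W hX ht

end Shapes

/-! ### Interface to S2b: `¬(T2γ)@3` in the `ℚ_q`-model currency -/

section Interface

variable (W : WeierstrassCurve ℚ) [W.IsElliptic] [W.IsGloballyMinimal]

omit [W.IsGloballyMinimal] in
/-- **`¬(T2γ)@3` ⟹ "every `q` with `3 ∣ c(E ⊗ ℚ_q)` is SPLIT multiplicative"** — the hypothesis
`hshape` of the sibling sub-target S2b's (T2β)@3 Shimura-road theorem, in its `ℚ_q`/`ℤ_q`-model
currency (multr1-p2's inert-prime Tamagawa lemmas). Proof: transport `c(E ⊗ ℚ_q)` to the factor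
`c_v` of `∏c_ℓ` at the place `v ↔ q` (`localTamagawaNumber_padic_eq`, Silverman *AEC* VII.6
Ex. 7.6 transport), apply `split_or_typeIV_of_odd_prime_dvd_localTamagawaNumber` at `p = 3`, and
transport split multiplicative reduction back to the prime
(`hasSplitMultiplicativeReductionAtPrime_iff_hasSplitMultiplicativeReductionAt`); the `IV`/`IV*`
alternative is excluded by `¬ ShapeGamma W`. [cite: SilvermanATAEC1994, IV.9.4 Steps 2, 5, 8 and Table 4.1 (PDF pp. 344–346)]
[cite: SilvermanAEC2009, VII.6 Ex. 7.6] -/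
theorem hasSplitMultiplicativeReductionAtPrime_of_three_dvd_of_not_shapeGamma (hγ : ¬ ShapeGamma W)
    (q : ℕ) [hq : Fact q.Prime] (h3 : 3 ∣ (W.baseChange ℚ_[q]).localTamagawaNumber ℤ_[q]) :
    W.HasSplitMultiplicativeReductionAtPrime q := by
  -- the place of `𝓞 ℚ` over `q`
  set v : HeightOneSpectrum (𝓞 ℚ) := (primesEquiv (R := 𝓞 ℚ)).symm ⟨q, hq.out⟩ with hvdef
  have hv : (primesEquiv v : ℕ) = q := by
    rw [hvdef, Equiv.apply_symm_apply]
  -- transport the `ℚ_q`-model Tamagawa number to the place-indexed factor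
  have h3' : 3 ∣ W.tamagawaNumberAt v := by
    rw [tamagawaNumberAt_def, ← WeierstrassCurve.localTamagawaNumber_padic_eq_holds W v q hv]
    exact h3
  rcases split_or_typeIV_of_odd_prime_dvd_localTamagawaNumber W v Nat.prime_three (by decide) h3'
    with ⟨hs, -⟩ | ⟨-, hk, hc⟩
  · -- split multiplicative at the place, hence at the prime `q`
    have hs' := (W.hasSplitMultiplicativeReductionAtPrime_iff_hasSplitMultiplicativeReductionAt v).mpr hs
    have key : ∀ (r : ℕ) (hr : Fact r.Prime), (primesEquiv v : ℕ) = r →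
        @WeierstrassCurve.HasSplitMultiplicativeReductionAtPrime W r hr := by
      rintro r hr rfl; exact hs'
    exact key q hq hv
  · exact absurd ⟨v, hk, hc⟩ hγ

omit [W.IsGloballyMinimal] in
/-- Packaged form of S2b's `hshape`. [folklore] -/
theorem hshape_of_not_shapeGamma (hγ : ¬ ShapeGamma W) :
    ∀ (q : ℕ) [Fact q.Prime], 3 ∣ (W.baseChange ℚ_[q]).localTamagawaNumber ℤ_[q] →
      W.HasSplitMultiplicativeReductionAtPrime q :=
  fun q _ h ↦ hasSplitMultiplicativeReductionAtPrime_of_three_dvd_of_not_shapeGamma W hγ q h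

omit [W.IsGloballyMinimal] in
/-- **On a semistable curve S2b's `hshape` holds unconditionally at `3`.** [folklore] -/
theorem hshape_of_semistable (hsst : Semistable W) :
    ∀ (q : ℕ) [Fact q.Prime], 3 ∣ (W.baseChange ℚ_[q]).localTamagawaNumber ℤ_[q] →
      W.HasSplitMultiplicativeReductionAtPrime q :=
  hshape_of_not_shapeGamma W (not_shapeGamma_of_semistable W hsst)

end Interface

end Summit.BirchSwinnertonDyer.Rank1Residual.X11b.Three

end
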